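import Summits.CriticalPhenomena.PercolationContinuityZ3.Theorems.PercNearOneGluingNoHeavyLowerTailThreePointProductFormFibreTwoPortSubstitutionCount
import HarnessLib

/-!
# The product form `#bad² ≤ #P1·#P2` in the fibre language: (P) TRANSFERS THROUGH A TERMINAL-FREE 2-CUT (REDUCTION R4)
# (Sahi programme, prover prim-sahi-p2 gen 55)

Support file (`--supports stmt-CriticalPhenomena-4575`, helper); conclusion of the formalisation of the TWO-TERMINAL SUBSTITUTION THEOREM (memo
`run/shared/lean/prim/prim-sahi/FROM-prim-sahi-p2-gen55-REDUCTIONS.md` §0(0)–§0(2), §3), after `…FibreTwoPortLocality`, `…FibreTwoPortSubstitution`,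
`…FibreTwoPortNetCounts`, `…FibreTwoPortSubstitutionCount`.  Standard axioms, no sorries, no named facts, no definitions.
* `card_conn_iff_split` [this work] — `#{p ↔ q in zn z} = A' + CD'`, `#{p ↮ q in zn z} = CD' + DD'` (the antithetic classes of the network).
* **`card_sa_substitution`** [this work] — THE SUBSTITUTION IDENTITY FOR `#P1` (and `#P2`, exchanging `s, c`):
  `#P1·#univ = (A' + CD')·σ(1) + (CD' + DD')·σ(0)`, `σ(e) := #{Rr z e a s ∧ ¬ Rr z e a c}` = `#P1` of the rest with the virtual edge in state `e`.
* **`productForm_of_twoPort`** [this work] — REDUCTION R4: if the three comparison triples (CONTRACT: `(Σ_π ρ(1,π,1), σ₁(1), σ₂(1))`; ONE EDGE: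
  `(ρ(1,∅,1) + ρ(0,∅,0) + Σ_{π≠∅}(ρ(1,π,0)+ρ(0,π,1)), σ₁(1)+σ₁(0), σ₂(1)+σ₂(0))`; DELETE: `(Σ_π ρ(0,π,0), σ₁(0), σ₂(0))`) each satisfy `b² ≤ p·q`,
  then `#bad² ≤ #P1·#P2` on `H` — by the two substitution identities and the convex-cone lemma `sq_add_le_mul_add`.  These triples ARE
  `(#bad, #P1, #P2)` of `H/N`, `H[N → pq]`, `H − N` written on the rest's labels (memo §3); so (P) for those three smaller multigraphs gives (P) for `H`,
  whatever the terminal-free network `N` — in a minimal counterexample to CONJECTURE (P) every terminal-free side of a 2-cut is a single label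
  (all ears are single edges, no parallel labels).
[folklore] (counting, Cauchy–Schwarz); [cite: Gladkov2024, Conjecture 10.1 (p. 18), arXiv:2408.08457] for CONJECTURE (P).
-/

namespace Summit.CriticalPhenomena.PercolationContinuityZ3.Theorems.ProductFormFibre

open Finset Literature.Probability.Percolation
open Summit.CriticalPhenomena.PercolationContinuityZ3.Theorems.ThreePointCPIClusterSwap (clusterFlip)

variable {V α : Type*}

section TwoPortProductForm

open Classical

variable [Fintype α] [DecidableEq α] (ends endsN : α → Sym2 V) (p q a s c : V) (Nv : Set V) (inN : α → Prop)
  (hN1 : ∀ l, inN l → ∀ v ∈ ends l, v ∈ Nv ∨ v = p ∨ v = q) (hN2 : ∀ l, ¬ inN l → ∀ v ∈ ends l, v ∉ Nv)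
  (hp : p ∉ Nv) (hq : q ∉ Nv) (ha : a ∉ Nv) (hs : s ∉ Nv) (hc : c ∉ Nv)
  (hE1 : ∀ l, inN l → endsN l = ends l) (hE2 : ∀ l, ¬ inN l → endsN l = s(p, p))
  (zn zr : (α → Bool) → α → Bool)
  (hzn : ∀ z l, inN l → zn z l = z l) (hzn0 : ∀ z l, ¬ inN l → zn z l = false)
  (hzr : ∀ z l, ¬ inN l → zr z l = z l) (hzr0 : ∀ z l, inN l → zr z l = false)
  (Rr : (α → Bool) → Bool → V → V → Prop)
  (hRr : ∀ z e u v, Rr z e u v ↔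
    ((openGraph (labelledOpen ends (zr z))).Reachable u v ∨
      (e = true ∧ (((openGraph (labelledOpen ends (zr z))).Reachable u p ∧ (openGraph (labelledOpen ends (zr z))).Reachable q v) ∨
        ((openGraph (labelledOpen ends (zr z))).Reachable u q ∧ (openGraph (labelledOpen ends (zr z))).Reachable p v)))))
  (Fl : (α → Bool) → Bool → α → Bool)
  (hFl1 : ∀ z e l, ¬ inN l → (∃ v ∈ ends l, Rr z e a v) → Fl z e l = !z l)
  (hFl2 : ∀ z e l, ¬ inN l → ¬ (∃ v ∈ ends l, Rr z e a v) → Fl z e l = z l)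
  (hFl0 : ∀ z e l, inN l → Fl z e l = false)
  (Fn : (α → Bool) → Bool → Bool → α → Bool)
  (hFn1 : ∀ z πp πq l, inN l →
    ((πp = true ∧ ∃ v ∈ ends l, (openGraph (labelledOpen ends (zn z))).Reachable p v) ∨
      (πq = true ∧ ∃ v ∈ ends l, (openGraph (labelledOpen ends (zn z))).Reachable q v)) → Fn z πp πq l = !z l)
  (hFn2 : ∀ z πp πq l, inN l →
    ¬ ((πp = true ∧ ∃ v ∈ ends l, (openGraph (labelledOpen ends (zn z))).Reachable p v) ∨
      (πq = true ∧ ∃ v ∈ ends l, (openGraph (labelledOpen ends (zn z))).Reachable q v)) → Fn z πp πq l = z l)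
  (hFn0 : ∀ z πp πq l, ¬ inN l → Fn z πp πq l = false)
  (Bd : (α → Bool) → Bool → Bool → Prop)
  (hBd : ∀ z e e', Bd z e e' ↔
    ((¬ Rr z e a s ∧ ¬ Rr z e a c ∧ ¬ Rr z e s c) ∧
      ((openGraph (labelledOpen ends (Fl z e))).Reachable s c ∨
        (e' = true ∧ (((openGraph (labelledOpen ends (Fl z e))).Reachable s p ∧ (openGraph (labelledOpen ends (Fl z e))).Reachable q c) ∨
          ((openGraph (labelledOpen ends (Fl z e))).Reachable s q ∧ (openGraph (labelledOpen ends (Fl z e))).Reachable p c))))))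
  (A' CD' DD' : ℕ)
  (hA' : A' = (univ.filter fun w : α → Bool => (openGraph (labelledOpen ends (zn w))).Reachable p q ∧
    (openGraph (labelledOpen ends (zn fun l => !w l))).Reachable p q).card)
  (hCD' : CD' = (univ.filter fun w : α → Bool => (openGraph (labelledOpen ends (zn w))).Reachable p q ∧
    ¬ (openGraph (labelledOpen ends (zn fun l => !w l))).Reachable p q).card)
  (hDD' : DD' = (univ.filter fun w : α → Bool => ¬ (openGraph (labelledOpen ends (zn w))).Reachable p q ∧
    ¬ (openGraph (labelledOpen ends (zn fun l => !w l))).Reachable p q).card)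

variable [DecidablePred inN]

omit [DecidablePred inN] in
include hA' hCD' hDD' in
/-- The two antithetic splits of the network's connection count: `#{p ↔ q in zn z} = A' + CD'` and `#{p ↮ q in zn z} = CD' + DD'`,
in the Boolean-indexed form `#{(p ↔ q in zn z) ↔ e}`. [this work] -/
theorem card_conn_iff_split (e : Bool) :
    (univ.filter fun z : α → Bool => (openGraph (labelledOpen ends (zn z))).Reachable p q ↔ e = true).card =
      bif e then A' + CD' else CD' + DD' := by
  have hDC : (univ.filter fun w : α → Bool => ¬ (openGraph (labelledOpen ends (zn w))).Reachable p q ∧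
      (openGraph (labelledOpen ends (zn fun l => !w l))).Reachable p q).card = CD' := by
    rw [hCD']
    exact card_filter_compl_swap (fun w => ¬ (openGraph (labelledOpen ends (zn w))).Reachable p q)
      (fun w => (openGraph (labelledOpen ends (zn w))).Reachable p q)
  cases e
  · simp only [Bool.false_eq_true, iff_false, cond_false]
    rw [← hDC, hDD', card_filter_split_bool (fun w : α → Bool => ¬ (openGraph (labelledOpen ends (zn w))).Reachable p q)
      (fun w => (openGraph (labelledOpen ends (zn fun l => !w l))).Reachable p q)]
    congr 1
    · exact congrArg Finset.card (Finset.filter_congr fun w _ => by simp only [iff_true])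
    · exact congrArg Finset.card (Finset.filter_congr fun w _ => by simp only [Bool.false_eq_true, iff_false])
  · simp only [iff_true, cond_true]
    rw [hA', hCD', card_filter_split_bool (fun w : α → Bool => (openGraph (labelledOpen ends (zn w))).Reachable p q)
      (fun w => (openGraph (labelledOpen ends (zn fun l => !w l))).Reachable p q)]
    congr 1
    · exact congrArg Finset.card (Finset.filter_congr fun w _ => by simp only [iff_true])
    · exact congrArg Finset.card (Finset.filter_congr fun w _ => by simp only [Bool.false_eq_true, iff_false])

include hN1 hN2 ha hs hc hzn hzn0 hzr hzr0 hRr hA' hCD' hDD' in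
/-- **THE SUBSTITUTION IDENTITY FOR `#P1`** (`#P2` by exchanging `s` and `c`): with `σ(e) := #{Rr z e a s ∧ ¬ Rr z e a c}`,
`#{a ↔ s, a ↮ c}·#univ = (A' + CD')·σ(1) + (CD' + DD')·σ(0)`. [this work] -/
theorem card_sa_substitution :
    (univ.filter fun z : α → Bool =>
        (openGraph (labelledOpen ends z)).Reachable a s ∧ ¬ (openGraph (labelledOpen ends z)).Reachable a c).card *
      (univ : Finset (α → Bool)).card =
    (A' + CD') * (univ.filter fun z : α → Bool => Rr z true a s ∧ ¬ Rr z true a c).card +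
    (CD' + DD') * (univ.filter fun z : α → Bool => Rr z false a s ∧ ¬ Rr z false a c).card := by
  have hsplit := card_filter_split_bool
    (fun z : α → Bool => (openGraph (labelledOpen ends z)).Reachable a s ∧ ¬ (openGraph (labelledOpen ends z)).Reachable a c)
    (fun z => (openGraph (labelledOpen ends (zn z))).Reachable p q)
  have hpiece : ∀ e : Bool, (univ.filter fun z : α → Bool =>
      ((openGraph (labelledOpen ends z)).Reachable a s ∧ ¬ (openGraph (labelledOpen ends z)).Reachable a c) ∧
        ((openGraph (labelledOpen ends (zn z))).Reachable p q ↔ e = true)).card * (univ : Finset (α → Bool)).card =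
      (bif e then A' + CD' else CD' + DD') * (univ.filter fun z : α → Bool => Rr z e a s ∧ ¬ Rr z e a c).card := by
    intro e
    have hre : (univ.filter fun z : α → Bool =>
        ((openGraph (labelledOpen ends z)).Reachable a s ∧ ¬ (openGraph (labelledOpen ends z)).Reachable a c) ∧
          ((openGraph (labelledOpen ends (zn z))).Reachable p q ↔ e = true)) =
      (univ.filter fun z : α → Bool => ((openGraph (labelledOpen ends (zn z))).Reachable p q ↔ e = true) ∧
        (Rr z e a s ∧ ¬ Rr z e a c)) := by
      refine Finset.filter_congr fun z _ => ?_
      constructor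
      · rintro ⟨h, he⟩
        exact ⟨he, (sa_iff_rest ends p q a Nv inN hN1 hN2 ha zn zr hzn hzn0 hzr hzr0 Rr hRr z e hs hc he).1 h⟩
      · rintro ⟨he, h⟩
        exact ⟨(sa_iff_rest ends p q a Nv inN hN1 hN2 ha zn zr hzn hzn0 hzr hzr0 Rr hRr z e hs hc he).2 h, he⟩
    rw [hre, ← card_conn_iff_split ends p q zn A' CD' DD' hA' hCD' hDD' e]
    refine card_and_mul_card_univ inN _ _ ?_ ?_
    · intro z z' h hz
      rwa [zn_eq_of_agree inN zn hzn hzn0 h] at hz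
    · intro z z' h hz
      have hR := fun (e : Bool) (u v : V) => Rr_iff_of_agree ends p q inN zr hzr hzr0 Rr hRr h e u v
      rwa [hR, hR] at hz
  beta_reduce at hsplit
  rw [hsplit, Nat.add_mul, hpiece true, hpiece false]
  simp only [cond_true, cond_false]

/-- The weighted three-term convex-cone lemma: `bᵢ² ≤ pᵢ qᵢ` for `i = 1, 2, 3` imply `(Σ λᵢbᵢ)² ≤ (Σ λᵢpᵢ)(Σ λᵢqᵢ)`. [folklore] -/
theorem sq_sum3_le (A C D b₁ b₂ b₃ p₁ p₂ p₃ q₁ q₂ q₃ : ℕ)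
    (h₁ : b₁ ^ 2 ≤ p₁ * q₁) (h₂ : b₂ ^ 2 ≤ p₂ * q₂) (h₃ : b₃ ^ 2 ≤ p₃ * q₃) :
    (A * b₁ + C * b₂ + D * b₃) ^ 2 ≤ (A * p₁ + C * p₂ + D * p₃) * (A * q₁ + C * q₂ + D * q₃) := by
  have g₁ : (A * b₁) ^ 2 ≤ (A * p₁) * (A * q₁) := by
    calc (A * b₁) ^ 2 = A * A * b₁ ^ 2 := by ring
      _ ≤ A * A * (p₁ * q₁) := Nat.mul_le_mul_left _ h₁
      _ = (A * p₁) * (A * q₁) := by ring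
  have g₂ : (C * b₂) ^ 2 ≤ (C * p₂) * (C * q₂) := by
    calc (C * b₂) ^ 2 = C * C * b₂ ^ 2 := by ring
      _ ≤ C * C * (p₂ * q₂) := Nat.mul_le_mul_left _ h₂
      _ = (C * p₂) * (C * q₂) := by ring
  have g₃ : (D * b₃) ^ 2 ≤ (D * p₃) * (D * q₃) := by
    calc (D * b₃) ^ 2 = D * D * b₃ ^ 2 := by ring
      _ ≤ D * D * (p₃ * q₃) := Nat.mul_le_mul_left _ h₃
      _ = (D * p₃) * (D * q₃) := by ring
  have g₁₂ := sq_add_le_mul_add _ _ _ _ _ _ g₁ g₂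
  exact sq_add_le_mul_add _ _ _ _ _ _ g₁₂ g₃

include hN1 hN2 hp hq ha hs hc hE1 hE2 hzn hzn0 hzr hzr0 hRr hFl1 hFl2 hFl0 hFn1 hFn2 hFn0 hBd hA' hCD' hDD' in
/-- **REDUCTION R4: (P) TRANSFERS THROUGH A TERMINAL-FREE TWO-TERMINAL NETWORK.**  Let `ρ(e,πp,πq,e') = #{Pat(e,πp,πq) ∧ BadR(e,e')}`,
`σ₁(e) = #{Rr z e a s ∧ ¬Rr z e a c}`, `σ₂(e) = #{Rr z e a c ∧ ¬Rr z e a s}` be the rest counts.  If the three comparison triples — CONTRACT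
`(Σ_π ρ(1,π,1), σ₁ 1, σ₂ 1)`, ONE EDGE `(ρ(1,∅,1) + ρ(0,∅,0) + Σ_{π≠∅}(ρ(1,π,0) + ρ(0,π,1)), σ₁ 1 + σ₁ 0, σ₂ 1 + σ₂ 0)`, DELETE `(Σ_π ρ(0,π,0), σ₁ 0, σ₂ 0)`
— each satisfy `b² ≤ p·q`, then `#bad² ≤ #P1·#P2` for the terminals `(s, a, c)` on the whole multigraph. [this work] -/
theorem productForm_of_twoPort (ρ : Bool → Bool → Bool → Bool → ℕ)
    (hρ : ∀ e πp πq e', ρ e πp πq e' =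
      (univ.filter fun z : α → Bool => ((Rr z e a p ↔ πp = true) ∧ (Rr z e a q ↔ πq = true)) ∧ Bd z e e').card)
    (σ₁ σ₂ : Bool → ℕ)
    (hσ₁ : ∀ e, σ₁ e = (univ.filter fun z : α → Bool => Rr z e a s ∧ ¬ Rr z e a c).card)
    (hσ₂ : ∀ e, σ₂ e = (univ.filter fun z : α → Bool => Rr z e a c ∧ ¬ Rr z e a s).card)
    (hcon : (ρ true true true true + ρ true true false true + ρ true false true true + ρ true false false true) ^ 2 ≤ σ₁ true * σ₂ true)
    (hedge : (ρ true false false true + ρ false false false false +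
        (ρ true true true false + ρ false true true true) + (ρ true true false false + ρ false true false true) +
        (ρ true false true false + ρ false false true true)) ^ 2 ≤ (σ₁ true + σ₁ false) * (σ₂ true + σ₂ false))
    (hdel : (ρ false true true false + ρ false true false false + ρ false false true false + ρ false false false false) ^ 2 ≤
      σ₁ false * σ₂ false) :
    (univ.filter fun z : α → Bool =>
        (¬ (openGraph (labelledOpen ends z)).Reachable a s ∧ ¬ (openGraph (labelledOpen ends z)).Reachable a c ∧
          ¬ (openGraph (labelledOpen ends z)).Reachable s c) ∧
        (openGraph (labelledOpen ends (clusterFlip ends a fun x => !z x))).Reachable s c).card ^ 2 ≤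
    (univ.filter fun z : α → Bool =>
        (openGraph (labelledOpen ends z)).Reachable a s ∧ ¬ (openGraph (labelledOpen ends z)).Reachable a c).card *
    (univ.filter fun z : α → Bool =>
        (openGraph (labelledOpen ends z)).Reachable a c ∧ ¬ (openGraph (labelledOpen ends z)).Reachable a s).card := by
  have hbad := card_bad_substitution ends endsN p q a s c Nv inN hN1 hN2 hp hq ha hs hc hE1 hE2 zn zr hzn hzn0 hzr hzr0 Rr hRr
    Fl hFl1 hFl2 hFl0 Fn hFn1 hFn2 hFn0 Bd hBd ρ hρ A' CD' DD' hA' hCD' hDD'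
  have hP1 := card_sa_substitution ends p q a s c Nv inN hN1 hN2 ha hs hc zn zr hzn hzn0 hzr hzr0 Rr hRr A' CD' DD' hA' hCD' hDD'
  have hP2 := card_sa_substitution ends p q a c s Nv inN hN1 hN2 ha hc hs zn zr hzn hzn0 hzr hzr0 Rr hRr A' CD' DD' hA' hCD' hDD'
  rw [← hσ₁, ← hσ₁] at hP1
  rw [← hσ₂, ← hσ₂] at hP2
  set U := (univ : Finset (α → Bool)).card with hU
  set B := (univ.filter fun z : α → Bool =>
        (¬ (openGraph (labelledOpen ends z)).Reachable a s ∧ ¬ (openGraph (labelledOpen ends z)).Reachable a c ∧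
          ¬ (openGraph (labelledOpen ends z)).Reachable s c) ∧
        (openGraph (labelledOpen ends (clusterFlip ends a fun x => !z x))).Reachable s c).card with hB
  set Q1 := (univ.filter fun z : α → Bool =>
        (openGraph (labelledOpen ends z)).Reachable a s ∧ ¬ (openGraph (labelledOpen ends z)).Reachable a c).card with hQ1
  set Q2 := (univ.filter fun z : α → Bool =>
        (openGraph (labelledOpen ends z)).Reachable a c ∧ ¬ (openGraph (labelledOpen ends z)).Reachable a s).card with hQ2
  have hUpos : 0 < U := Finset.card_pos.mpr Finset.univ_nonempty
  -- the three-term cone lemma on the substituted forms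
  have key := sq_sum3_le A' CD' DD' _ _ _ _ _ _ _ _ _ hcon hedge hdel
  have eB : B * U = A' * (ρ true true true true + ρ true true false true + ρ true false true true + ρ true false false true) +
      CD' * (ρ true false false true + ρ false false false false +
        (ρ true true true false + ρ false true true true) + (ρ true true false false + ρ false true false true) +
        (ρ true false true false + ρ false false true true)) +
      DD' * (ρ false true true false + ρ false true false false + ρ false false true false + ρ false false false false) := hbad
  have eQ1 : Q1 * U = A' * σ₁ true + CD' * (σ₁ true + σ₁ false) + DD' * σ₁ false := by rw [hP1]; ring
  have eQ2 : Q2 * U = A' * σ₂ true + CD' * (σ₂ true + σ₂ false) + DD' * σ₂ false := by rw [hP2]; ring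
  have key' : (B * U) ^ 2 ≤ (Q1 * U) * (Q2 * U) := by rw [eB, eQ1, eQ2]; exact key
  have key'' : B ^ 2 * (U * U) ≤ Q1 * Q2 * (U * U) := by
    calc B ^ 2 * (U * U) = (B * U) ^ 2 := by ring
      _ ≤ (Q1 * U) * (Q2 * U) := key'
      _ = Q1 * Q2 * (U * U) := by ring
  exact Nat.le_of_mul_le_mul_right key'' (Nat.mul_pos hUpos hUpos)

end TwoPortProductForm

end Summit.CriticalPhenomena.PercolationContinuityZ3.Theorems.ProductFormFibre
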